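import Literature.AlgebraicGeometry.Motives.CrystallineRealization
import Literature.AlgebraicGeometry.Motives.Sweep1
import Literature.AlgebraicGeometry.Resolution.ChowLemmaRing
import Literature.AlgebraicGeometry.Motives.ZariskiChowCover
import Literature.AlgebraicGeometry.Morphisms.SteinFactorizationProofs
import Literature.AlgebraicGeometry.Motives.SmoothOverRegularBase
import Literature.AlgebraicGeometry.Resolution.RegularLocalRingsNormal
import Literature.AlgebraicGeometry.Resolution.ReducedOfSmoothOverReduced
import Mathlib.RingTheory.WittVector.DiscreteValuationRing
import HarnessLib

/-!
# `FormalVectorBundlesAlgebraize` (stmt-HodgeConjecture-14106) · line `chow-zariski-pushforward` ·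
# the Chow cover of a smooth proper model, with `ρ_* 𝒪 = 𝒪`

Frame stub `stub_chowCoverNormal` of the lead's skeleton for the crux
`PadicSemiregularLift.FormalVectorBundlesAlgebraize`: for `k` a perfect field of characteristic `p`,
`W = W(k)` and `𝒳 / W` a smooth proper model (`WittScheme.IsSmoothProperModel d 𝒳`), there are a
`W`-scheme `𝒳'` which is INTEGRAL, `W`-PROJECTIVE (`ChowLemmaRing.IsProjOver`) and `W`-FLAT, and a
`W`-morphism `ρ : 𝒳' ⟶ 𝒳` with `ρ.left` proper and `𝒪_𝒳(U) ≅ 𝒪_{𝒳'}(ρ⁻¹ U)` for every open `U`.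

The proof is three hypothesis checks of proved tree theorems:

* `𝒳` is integral with normal local rings and surjects onto `Spec W` (`isIntegral_left`,
  `isIntegrallyClosed_stalk`, `surjective_hom`): `W` is a discrete valuation ring (Mathlib
  `WittVector.isDiscreteValuationRing`), so `𝒳` is reduced (smooth over the reduced Noetherian
  `Spec W`, `Resolution.isReduced_of_smooth_of_isReduced_base`) and irreducible (its generic fibre is
  geometrically irreducible and dense, `ZariskiChow.irreducibleSpace_of_genericFibre`); its local
  rings are regular (`isRegularLocalRing_stalk_of_smoothOfRelativeDimension_specOfRegular`), hence
  integrally closed (`Resolution.isIntegrallyClosed_of_isRegularLocalRing`); its image in `Spec W`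
  is open, closed and non-empty.
* Chow's lemma over `W` (`ChowLemmaRing.chow_proper`): `π : X' → 𝒳` proper surjective, `X'`
  integral with a closed `W`-immersion into some `ℙⁿ_W`, `π` an isomorphism over a dense open `U`;
  `𝒳' := Over.mk (π ≫ 𝒳.hom)` is flat over `W` (`ZariskiChow.flat_of_isIntegral_of_surjective`).
* `π_* 𝒪_{X'} = 𝒪_𝒳` by Stacks 0AY8 (`Morphisms.TowardsNormal.isIso_app`): the generic point of
  `X'` maps to the generic point `ξ` of `𝒳` (`apply_genericPoint_eq`) and the fibre `X'_ξ → Spec κ(ξ)`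
  is an isomorphism, being a base change of the isomorphism `π ∣_ U`, `ξ ∈ U`
  (`isIso_fiberToSpecResidueField_of_mem`).

References: The Stacks Project, Tags 02O2 (Chow's lemma), 0AY8 (More on Morphisms, Lemma 37.53.6);
R. Hartshorne, *Algebraic Geometry*, III Prop. 9.7 and the proof of III Cor. 11.4.

Provenance: Literature home (family `hodge`, layer `Literature/AlgebraicGeometry/FormalGeometry`, namespace
`Literature.AlgebraicGeometry.FormalGeometry.WittGrothendieckExistence…`) of the Summits-side
`Theorems/PadicSemiregularLiftFormalVectorBundlesAlgebraizeChowCoverNormal` (route `PadicSemiregularLift` / `AnchorTransport`,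
Grothendieck existence for vector bundles over `W(k)`), which `Literature/` may not import; theorems only, no
named fact, no definition. Lane `lit-hodgefound`, seat p20.
-/

noncomputable section

open CategoryTheory CategoryTheory.Limits _root_.AlgebraicGeometry
open Literature.AlgebraicGeometry.Motives Literature.AlgebraicGeometry.Motives.WittScheme
open Literature.AlgebraicGeometry.Resolution

namespace Literature.AlgebraicGeometry.FormalGeometry.WittGrothendieckExistence.FormalVectorBundlesAlgebraize

universe u

/-! ### Morphisms which are isomorphisms over an open of the target -/

section General

variable {X Y : Scheme.{u}} (π : X ⟶ Y)

/-- A surjective morphism between irreducible schemes maps the generic point to the generic point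
(the closure of its image contains the image of the whole space). [cite: GortzWedhorn2023, proof of Thm. 24.94 and Prop. 24.95 (pp. 566–567), auxiliary step] -/
theorem apply_genericPoint_eq [IrreducibleSpace X] [IrreducibleSpace Y] [Surjective π] :
    π.base (genericPoint X) = genericPoint Y := by
  have h := (genericPoint_spec X).image π.continuous
  rw [Set.image_univ_of_surjective π.surjective, closure_univ] at h
  exact h.eq (genericPoint_spec Y)

/-- If `π : X → Y` restricts to an isomorphism over the open `U ⊆ Y`, then its base change along any
morphism `T → Y` factoring through `U` is an isomorphism. [cite: GortzWedhorn2023, proof of Thm. 24.94 and Prop. 24.95 (pp. 566–567), auxiliary step] -/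
theorem isIso_pullbackSnd_of_isIso_morphismRestrict (U : Y.Opens) [IsIso (π ∣_ U)]
    {T : Scheme.{u}} (ψ : T ⟶ Y) (g : T ⟶ U) (hψ : ψ = g ≫ U.ι) : IsIso (pullback.snd π ψ) := by
  subst hψ
  haveI : IsIso (pullback.snd π U.ι) := by
    rw [← pullbackRestrictIsoRestrict_hom_morphismRestrict]
    infer_instance
  haveI : IsIso ((pullbackLeftPullbackSndIso π U.ι g).hom ≫ pullback.snd π (g ≫ U.ι)) := by
    rw [pullbackLeftPullbackSndIso_hom_snd]
    infer_instance
  exact IsIso.of_isIso_comp_left (pullbackLeftPullbackSndIso π U.ι g).hom _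

/-- If `π : X → Y` restricts to an isomorphism over the open `U ⊆ Y` and `y ∈ U`, then the
scheme-theoretic fibre `X_y → Spec κ(y)` is an isomorphism. [cite: GortzWedhorn2023, proof of Thm. 24.94 and Prop. 24.95 (pp. 566–567), auxiliary step] -/
theorem isIso_fiberToSpecResidueField_of_mem (U : Y.Opens) [IsIso (π ∣_ U)] {y : Y} (hy : y ∈ U) :
    IsIso (π.fiberToSpecResidueField y) := by
  have hrange : Set.range (Y.fromSpecResidueField y) ⊆ Set.range U.ι := by
    rw [Scheme.range_fromSpecResidueField, Scheme.Opens.range_ι, Set.singleton_subset_iff]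
    exact hy
  exact isIso_pullbackSnd_of_isIso_morphismRestrict π U (Y.fromSpecResidueField y)
    (IsOpenImmersion.lift U.ι _ hrange) (IsOpenImmersion.lift_fac _ _ hrange).symm

/-- **`π_* 𝒪_X = 𝒪_Y` for a proper surjective `π : X → Y` between integral schemes which is an
isomorphism over a non-empty open of the normal scheme `Y`** (Stacks 0AY8, via
`Morphisms.TowardsNormal.isIso_app`): `𝒪_Y(V) → 𝒪_X(π⁻¹ V)` is an isomorphism for every open `V`. [cite: GortzWedhorn2023, proof of Thm. 24.94 and Prop. 24.95 (pp. 566–567), auxiliary step] -/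
theorem isIso_app_of_isIso_morphismRestrict [IsIntegral X] [IsIntegral Y] [IsProper π]
    [Surjective π] (hY : ∀ y : Y, IsIntegrallyClosed (Y.presheaf.stalk y)) (U : Y.Opens)
    (hU : (U : Set Y).Nonempty) [IsIso (π ∣_ U)] (V : Y.Opens) : IsIso (π.app V) := by
  haveI : Nonempty U := by
    obtain ⟨y, hy⟩ := hU
    exact ⟨⟨y, hy⟩⟩
  have hξU : genericPoint Y ∈ U :=
    Literature.AlgebraicGeometry.Morphisms.TowardsNormal.genericPoint_mem Y U
  have hX : ∀ x ∈ genericPoints X, π.base x = genericPoint Y := by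
    intro x hx
    rw [genericPoints_eq_singleton, Set.mem_singleton_iff] at hx
    rw [hx]
    exact apply_genericPoint_eq π
  haveI := isIso_fiberToSpecResidueField_of_mem π U hξU
  -- `appTop` is `app ⊤` at the target `Γ(X_ξ, ⊤) = Γ(X_ξ, p⁻¹ ⊤)` (definitionally)
  have hξ : IsIso (π.fiberToSpecResidueField (genericPoint Y)).appTop :=
    (inferInstance : IsIso ((π.fiberToSpecResidueField (genericPoint Y)).app ⊤))
  exact Literature.AlgebraicGeometry.Morphisms.TowardsNormal.isIso_app π hY hX hξ V

end General

/-! ### Smooth proper models over `W(k)` -/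

section Model

variable {p : ℕ} [Fact p.Prime] {k : Type} [Field k] [CharP k p] [PerfectRing k p] {d : ℕ}
  {𝒳 : SchemeOver (WittVector p k)} (h𝒳 : IsSmoothProperModel d 𝒳)
include h𝒳

omit [PerfectRing k p] in
/-- The generic fibre `𝒳 ×_W Spec K`, `K = Frac W`, of a smooth proper model is irreducible (it is
geometrically irreducible over the field `K`). [cite: GortzWedhorn2023, proof of Thm. 24.94 and Prop. 24.95 (pp. 566–567), auxiliary step] -/
theorem irreducibleSpace_genericFibre :
    IrreducibleSpace ↥(pullback 𝒳.hom (Spec.map (CommRingCat.ofHom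
      (algebraMap (WittVector p k) (FractionRing (WittVector p k)))))) :=
  haveI : GeometricallyIrreducible (pullback.snd 𝒳.hom (Spec.map (CommRingCat.ofHom
      (algebraMap (WittVector p k) (FractionRing (WittVector p k)))))) :=
    h𝒳.isSmoothProjective_genericFibre.geometricallyIrreducible
  GeometricallyIrreducible.irreducibleSpace_of_subsingleton (f := pullback.snd 𝒳.hom
    (Spec.map (CommRingCat.ofHom (algebraMap (WittVector p k) (FractionRing (WittVector p k))))))

/-- **The total space of a smooth proper model over `W(k)` is integral**: reduced, being smooth over
the reduced Noetherian `Spec W` (Stacks 034E), and irreducible, its generic fibre being irreducible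
and dense (`𝒳 → Spec W` is universally open). [cite: GortzWedhorn2023, proof of Thm. 24.94 and Prop. 24.95 (pp. 566–567), auxiliary step] -/
theorem isIntegral_left : IsIntegral 𝒳.left := by
  haveI := h𝒳.smoothOfRelativeDimension
  haveI : Smooth 𝒳.hom := SmoothOfRelativeDimension.smooth d _
  haveI := irreducibleSpace_genericFibre h𝒳
  haveI : IrreducibleSpace ↥𝒳.left :=
    ZariskiChow.irreducibleSpace_of_genericFibre (K := FractionRing (WittVector p k)) 𝒳.hom
  haveI : IsReduced 𝒳.left :=
    Literature.AlgebraicGeometry.Resolution.isReduced_of_smooth_of_isReduced_base 𝒳.hom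
  exact isIntegral_of_irreducibleSpace_of_isReduced _

/-- A smooth proper model `𝒳 → Spec W(k)` is surjective: its image is open (universally open),
closed (proper) and non-empty in the irreducible `Spec W`. [cite: GortzWedhorn2023, proof of Thm. 24.94 and Prop. 24.95 (pp. 566–567), auxiliary step] -/
theorem surjective_hom : Surjective 𝒳.hom := by
  haveI := h𝒳.smoothOfRelativeDimension
  haveI := h𝒳.isProper
  haveI : Smooth 𝒳.hom := SmoothOfRelativeDimension.smooth d _
  haveI := isIntegral_left h𝒳
  have hopen : IsOpen (Set.range 𝒳.hom.base) := 𝒳.hom.isOpenMap.isOpen_range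
  have hclosed : IsClosed (Set.range 𝒳.hom.base) := 𝒳.hom.isClosedMap.isClosed_range
  exact ⟨Set.range_eq_univ.mp (IsClopen.eq_univ ⟨hclosed, hopen⟩ (Set.range_nonempty _))⟩

/-- **The local rings of a smooth proper model over `W(k)` are integrally closed**: they are regular
(smooth over the regular ring `W`, Stacks 036D), and regular local rings are normal (Matsumura,
Thm. 19.4). [cite: GortzWedhorn2023, proof of Thm. 24.94 and Prop. 24.95 (pp. 566–567), auxiliary step] -/
theorem isIntegrallyClosed_stalk (x : 𝒳.left) : IsIntegrallyClosed (𝒳.left.presheaf.stalk x) := by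
  haveI := h𝒳.smoothOfRelativeDimension
  haveI : IsRegularLocalRing (𝒳.left.presheaf.stalk x) :=
    isRegularLocalRing_stalk_of_smoothOfRelativeDimension_specOfRegular 𝒳.hom d x
  exact Literature.AlgebraicGeometry.Resolution.isIntegrallyClosed_of_isRegularLocalRing _

end Model

/-! ### The registered stub -/

/-- **Chow cover of a smooth proper model with `ρ_* 𝒪 = 𝒪`** (frame stub `stub_chowCoverNormal` of
line `chow-zariski-pushforward`). For `k` perfect of characteristic `p` and `𝒳 / W(k)` a smooth proper
model there are an integral, `W`-projective, `W`-flat `W`-scheme `𝒳'` and a `W`-morphism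
`ρ : 𝒳' ⟶ 𝒳` with `ρ.left` proper and `𝒪_𝒳(U) → 𝒪_{𝒳'}(ρ⁻¹ U)` an isomorphism for every open `U`:
Chow's lemma over `W` (`ChowLemmaRing.chow_proper`) applied to the integral `𝒳`, flatness of the
integral cover over the discrete valuation ring `W` (`ZariskiChow.flat_of_isIntegral_of_surjective`),
and Stacks 0AY8 for the proper birational `π` onto the normal `𝒳`
(`isIso_app_of_isIso_morphismRestrict`). [cite: GortzWedhorn2023, proof of Thm. 24.94 and Prop. 24.95 (pp. 566–567), auxiliary step] -/
theorem stub_chowCoverNormal :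
    ∀ (p : ℕ) [Fact p.Prime] (k : Type) [Field k] [CharP k p] [PerfectRing k p] (d : ℕ)
      (𝒳 : SchemeOver (WittVector p k)), IsSmoothProperModel d 𝒳 →
      ∃ (𝒳' : SchemeOver (WittVector p k)) (ρ : 𝒳' ⟶ 𝒳),
        IsIntegral 𝒳'.left ∧ ChowLemmaRing.IsProjOver 𝒳' ∧ Flat 𝒳'.hom ∧ IsProper ρ.left ∧
          ∀ U : 𝒳.left.Opens, IsIso (ρ.left.app U) := by
  intro p _ k _ _ _ d 𝒳 h𝒳
  haveI := h𝒳.isProper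
  haveI := isIntegral_left h𝒳
  haveI := surjective_hom h𝒳
  obtain ⟨n, X', π, ι, hint, hι, hπ, hsurj, hcomm, U, hUd, -, hiso⟩ :=
    ChowLemmaRing.chow_proper 𝒳.left 𝒳.hom
  haveI := hint
  haveI := hπ
  haveI := hsurj
  haveI := hiso
  refine ⟨Over.mk (π ≫ 𝒳.hom), Over.homMk π rfl, hint, ⟨n, Over.homMk ι hcomm, hι⟩, ?_, hπ,
    fun V => ?_⟩
  · exact ZariskiChow.flat_of_isIntegral_of_surjective (π ≫ 𝒳.hom)
  · exact isIso_app_of_isIso_morphismRestrict π (isIntegrallyClosed_stalk h𝒳) U hUd.nonempty V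

end Literature.AlgebraicGeometry.FormalGeometry.WittGrothendieckExistence.FormalVectorBundlesAlgebraize

end
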